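import Summits.QuantumFields.YangMills.Theorems.UnitScaleTiltProp7FlatFaberKrahnZd
import Summits.QuantumFields.YangMills.Theorems.UnitScaleTiltProp7FlatLevelIteration
import HarnessLib

/-!
# Line «poincare_lipschitz» on crux `HistoryTailL` (stmt-QuantumFields-19936), route crux `BlockLipschitzL` (stmt-QuantumFields-23533), K2 supplier plan,
# (R3)-COV brick (b-corrector), scalar half — THE DE GIORGI ∕ STAMPACCHIA SUP BOUND ON `ℤ^d` FROM THE TRUNCATION-ENERGY INEQUALITY ALONE:
# `z ≥ 0`, `z = 0` off `Q_r(z₀)`, `∀ k ≥ 0: Σ_{Q_{r+1}}|∇(z−k)₊|² ≤ 2d·m²·#{z > k}` ⟹ `z ≤ 64·2^d·d·m·(2r+1)` — the energy-form re-cut of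
# ✓`Prop7FlatDirichletSup.le_of_dirichlet`, so that the VECTOR∕COVARIANT Dirichlet corrector plugs in through `z := ‖w‖`

Cell `ym3-torus` (YM ladder rung R3 = continuum SU(2) Yang–Mills on the three-torus — a RUNG, NOT the Clay problem: not d = 4, not infinite volume, not a
mass gap); width seat `ym3-torus-px7` gen 4 («COV-DIRICHLET-SUP», bus 2026-08-29T01:24Z; LEAD ym-ust-19936-w1 g7's covariant road, card v1.29).  THEOREMS ONLY
(def-free); flat, scalar; `--supports stmt-QuantumFields-23533`.  Nothing here proves the (R3)-COV row, `hStab`, F5/F6, a stub, `BlockLipschitzL`, `HistoryTailL` or a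
summit statement.

WHY.  ✓`Prop7FlatDirichletSup.abs_le_of_dirichlet` (w1-19200 g6) proves `|w| ≤ 64·2^d·d·m·(2r+1)` for the FLAT SCALAR box Dirichlet corrector `−Δw = ∂*g`,
`|g| ≤ m`, by level truncation: the equation enters ONLY through ✓`truncation_energy_le` (`Σ|∇(w−k)₊|² ≤ 2d·m²·#{w>k}`); the rest (✓`faberKrahn`, the De Giorgi step,
✓`levels_vanish`) is about the scalar `w` alone.  For the COVARIANT corrector `(Σ_μ D*_μD_μ)w = Σ_μ D*_μ g_μ` with `M_n(ℂ)`-valued `w` the same energy inequality holds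
for the SCALAR `z := ‖w‖` (vector truncation `w − P_{B(0,k)}w`, firm non-expansiveness of `I − P`, isometric transports — sibling file `…CovariantDirichletSup`), so the
scalar iteration must be available with the ENERGY INEQUALITY AS THE HYPOTHESIS.  This file is exactly that re-cut; the flat theorem is the special case `z = w`.

* `deGiorgi_step_of_energy` — `z = 0` off `Q_r(z₀)`, energy inequality at level `k ≥ 0`, `4·#{z > k} ≤ ρ^d` (`ρ ≥ 1`), `h > k` ⟹
  `(h−k)²·#{z > h} ≤ 8d²m²ρ²·#{z > k}` (✓`faberKrahn` + the hypothesis; copy of ✓`deGiorgi_step` with `truncation_energy_le` replaced by the hypothesis).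
* ★★ `le_of_energy` — `d ≥ 1`, `r ≥ 0`, `m ≥ 0`, `z = 0` off `Q_r(z₀)`, energy inequality at EVERY `k ≥ 0` ⟹ `z(y) ≤ 64·2^d·d·m·(2r+1)` for every `y`
  (✓`levels_vanish`; copy of ✓`le_of_dirichlet`).
[folklore] ([Giaquinta1984] Ch. III §2; De Giorgi 1957 ∕ Stampacchia; [Balaban1984PropagatorsII] (1.9) p.226 is the print locus of the flat constants).
-/

set_option autoImplicit false

noncomputable section

open scoped BigOperators
open Finset

namespace Summit.QuantumFields.YangMills.Theorems.PoincareLipschitzDirichletSupOfEnergy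

open Literature.MathematicalPhysics.QuantumFieldTheory.Balaban1983to89
open B4Eq19LatticeOperators
open Summit.QuantumFields.YangMills.Theorems.Prop7FlatFaberKrahnZd (faberKrahn)
open Summit.QuantumFields.YangMills.Theorems.Prop7FlatLevelIteration (levels_vanish)

variable {d : ℕ}

/-- **ONE DE GIORGI STEP FROM THE ENERGY INEQUALITY.**  `z = 0` off `Q_r(z₀)`; at the level `k ≥ 0` the truncation energy obeys
`Σ_{Q_{r+1}(z₀)} Σ_μ (∂_μ(z−k)₊)² ≤ 2d·m²·#{y ∈ Q_r(z₀) : z(y) > k}`; if `4·#{z > k} ≤ ρ^d` for a tile side `ρ ≥ 1`, then for every `h > k`: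
`(h−k)²·#{z > h} ≤ 8d²·m²·ρ²·#{z > k}`. [folklore] [cite: Giaquinta1984, Ch. III §2 p.78] -/
theorem deGiorgi_step_of_energy {z : Zd d → ℝ} {z₀ : Zd d} {r : ℤ} {m : ℝ} (hz0 : ∀ y ∉ box z₀ r, z y = 0) {k h : ℝ} (hk : 0 ≤ k) (hkh : k < h)
    (hEn : ∑ y ∈ box z₀ (r + 1), ∑ μ, fdiff μ (fun x => max (z x - k) 0) y ^ 2 ≤
      2 * d * m ^ 2 * (((box z₀ r).filter fun y => k < z y).card : ℝ))
    {ρ : ℕ} (hρ : 1 ≤ ρ) (hA : 4 * ((box z₀ r).filter fun y => k < z y).card ≤ ρ ^ d) :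
    (h - k) ^ 2 * (((box z₀ r).filter fun y => h < z y).card : ℝ) ≤
      8 * (d : ℝ) ^ 2 * m ^ 2 * (ρ : ℝ) ^ 2 * (((box z₀ r).filter fun y => k < z y).card : ℝ) := by
  classical
  set φ : Zd d → ℝ := fun x => max (z x - k) 0 with hφ
  set Ak := (box z₀ r).filter fun y => k < z y with hAk
  set Ah := (box z₀ r).filter fun y => h < z y with hAh
  have hφ0 : ∀ y ∉ box z₀ r, φ y = 0 := fun y hy => by
    simp only [hφ, hz0 y hy, zero_sub, max_eq_right (neg_nonpos.mpr hk)]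
  have hS : ∀ x, φ x ≠ 0 → x ∈ Ak := by
    intro x hx
    have hxb : x ∈ box z₀ r := by
      by_contra h0
      exact hx (hφ0 x h0)
    rw [hAk, Finset.mem_filter]
    refine ⟨hxb, ?_⟩
    by_contra hle
    push Not at hle
    exact hx (by simp only [hφ]; exact max_eq_right (by linarith))
  have hT : ∀ (x : Zd d) (i : Fin d), fdiff i φ x ≠ 0 → x ∈ box z₀ (r + 1) := by
    intro x i hx
    have : φ x ≠ 0 ∨ φ (x + unitVec i) ≠ 0 := by
      by_contra hboth
      push Not at hboth
      exact hx (by rw [fdiff_apply, hboth.1, hboth.2, sub_zero])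
    rcases this with h0 | h0
    · exact box_mono z₀ (by linarith) (Finset.mem_filter.mp (hS _ h0)).1
    · have hmem := (Finset.mem_filter.mp (hS _ h0)).1
      have := sub_unitVec_mem_box hmem i
      simpa using this
  -- Faber–Krahn + the energy hypothesis
  have hFK := faberKrahn (f := φ) hS hT hρ hA
  have hρ1 : (1 : ℝ) ≤ ρ := by exact_mod_cast hρ
  have hcoef : 4 * ((d : ℝ) * ρ * ((ρ : ℝ) - 1)) ≤ 4 * (d : ℝ) * (ρ : ℝ) ^ 2 := by
    have : (0 : ℝ) ≤ d := Nat.cast_nonneg d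
    nlinarith
  have hEn0 : 0 ≤ ∑ y ∈ box z₀ (r + 1), ∑ μ, fdiff μ φ y ^ 2 := Finset.sum_nonneg fun _ _ => Finset.sum_nonneg fun _ _ => sq_nonneg _
  have hmass : ∑ x ∈ Ak, φ x ^ 2 ≤ 8 * (d : ℝ) ^ 2 * m ^ 2 * (ρ : ℝ) ^ 2 * (Ak.card : ℝ) := by
    calc ∑ x ∈ Ak, φ x ^ 2 ≤ 4 * ((d : ℝ) * ρ * ((ρ : ℝ) - 1)) * ∑ x ∈ box z₀ (r + 1), ∑ i : Fin d, fdiff i φ x ^ 2 := hFK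
      _ ≤ 4 * (d : ℝ) * (ρ : ℝ) ^ 2 * ∑ x ∈ box z₀ (r + 1), ∑ i : Fin d, fdiff i φ x ^ 2 := mul_le_mul_of_nonneg_right hcoef hEn0
      _ ≤ 4 * (d : ℝ) * (ρ : ℝ) ^ 2 * (2 * d * m ^ 2 * (Ak.card : ℝ)) := mul_le_mul_of_nonneg_left hEn (by positivity)
      _ = 8 * (d : ℝ) ^ 2 * m ^ 2 * (ρ : ℝ) ^ 2 * (Ak.card : ℝ) := by ring
  -- on `{z > h}` the truncation is at least `h − k`
  have hsub : Ah ⊆ Ak := by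
    intro y hy
    rw [hAh, Finset.mem_filter] at hy
    rw [hAk, Finset.mem_filter]
    exact ⟨hy.1, lt_trans hkh hy.2⟩
  have hlow : (h - k) ^ 2 * (Ah.card : ℝ) ≤ ∑ x ∈ Ak, φ x ^ 2 := by
    calc (h - k) ^ 2 * (Ah.card : ℝ) = ∑ x ∈ Ah, (h - k) ^ 2 := by rw [Finset.sum_const, nsmul_eq_mul]; ring
      _ ≤ ∑ x ∈ Ah, φ x ^ 2 := by
          refine Finset.sum_le_sum fun x hx => ?_
          rw [hAh, Finset.mem_filter] at hx
          have hle : h - k ≤ φ x := by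
            simp only [hφ]
            exact le_trans (by linarith [hx.2]) (le_max_left _ _)
          exact pow_le_pow_left₀ (by linarith) hle 2
      _ ≤ ∑ x ∈ Ak, φ x ^ 2 := Finset.sum_le_sum_of_subset_of_nonneg hsub fun _ _ _ => sq_nonneg _
  exact hlow.trans hmass

/-- ★★ **THE SUP BOUND FROM THE ENERGY INEQUALITY.**  `d ≥ 1`, `r ≥ 0`, `m ≥ 0`; if `z = 0` off `Q_r(z₀)` and for EVERY level `k ≥ 0`
`Σ_{Q_{r+1}(z₀)} Σ_μ (∂_μ(z−k)₊)² ≤ 2d·m²·#{y ∈ Q_r(z₀) : z(y) > k}`, then `z(y) ≤ 64·2^d·d·m·(2r+1)` for every `y ∈ ℤ^d` (level iteration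
✓`levels_vanish` at the levels `D(1−2^{−n})`).  The flat Dirichlet corrector (✓`le_of_dirichlet`) is the case where the energy inequality comes from
✓`truncation_energy_le`; the covariant one feeds `z := ‖w‖`. [folklore] [cite: Giaquinta1984, Ch. III §2 p.78; Balaban1984PropagatorsII, (1.9) p.226] -/
theorem le_of_energy (hd : 1 ≤ d) {z : Zd d → ℝ} {z₀ : Zd d} {r : ℤ} (hr : 0 ≤ r) {m : ℝ} (hm : 0 ≤ m) (hz0 : ∀ y ∉ box z₀ r, z y = 0)
    (hEn : ∀ k : ℝ, 0 ≤ k → ∑ y ∈ box z₀ (r + 1), ∑ μ, fdiff μ (fun x => max (z x - k) 0) y ^ 2 ≤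
      2 * d * m ^ 2 * (((box z₀ r).filter fun y => k < z y).card : ℝ)) (y : Zd d) :
    z y ≤ 64 * (2 : ℝ) ^ d * d * m * (2 * (r : ℝ) + 1) := by
  classical
  set A : ℝ → ℕ := fun k => ((box z₀ r).filter fun x => k < z x).card with hA
  have hmono : ∀ k h : ℝ, k ≤ h → A h ≤ A k := fun k h hkh =>
    Finset.card_le_card fun x hx => by
      rw [Finset.mem_filter] at hx ⊢
      exact ⟨hx.1, lt_of_le_of_lt hkh hx.2⟩
  set M : ℕ := (2 * r + 1).toNat with hM
  have hMR : ((M : ℕ) : ℝ) = 2 * (r : ℝ) + 1 := by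
    have : ((M : ℕ) : ℤ) = 2 * r + 1 := by rw [hM]; exact Int.toNat_of_nonneg (by linarith)
    exact_mod_cast this
  have hM1 : 1 ≤ M := by rw [hM]; omega
  have hA0 : A 0 ≤ M ^ d := by
    have h1 : A 0 ≤ (box z₀ r).card := Finset.card_filter_le _ _
    have h2 : ((box z₀ r).card : ℝ) = ((2 * r + 1 : ℤ) : ℝ) ^ d := card_box z₀ hr
    have h3 : ((box z₀ r).card : ℝ) = ((M ^ d : ℕ) : ℝ) := by rw [h2]; push_cast; rw [hMR]
    have h4 : (box z₀ r).card = M ^ d := by exact_mod_cast h3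
    omega
  have hstep : ∀ (k h : ℝ) (ρ : ℕ), 0 ≤ k → k < h → 1 ≤ ρ → 4 * A k ≤ ρ ^ d →
      (h - k) ^ 2 * (A h : ℝ) ≤ (8 * (d : ℝ) ^ 2 * m ^ 2) * (ρ : ℝ) ^ 2 * (A k : ℝ) := by
    intro k h ρ hk hkh hρ hAk
    have := deGiorgi_step_of_energy (m := m) hz0 hk hkh (hEn k hk) hρ hAk
    simp only [hA]
    linarith
  have hC : 0 ≤ 8 * (d : ℝ) ^ 2 * m ^ 2 := by positivity
  have hbound : ∀ D : ℝ, 0 < D → 256 * (2 : ℝ) ^ d * (8 * (d : ℝ) ^ 2 * m ^ 2) * (M : ℝ) ^ 2 ≤ D ^ 2 → z y ≤ D := by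
    intro D hD hD2
    have hAD := levels_vanish hd A hmono hM1 hA0 hC hstep hD hD2
    by_cases hy : y ∈ box z₀ r
    · by_contra hlt
      push Not at hlt
      have : y ∈ (box z₀ r).filter fun x => D < z x := Finset.mem_filter.mpr ⟨hy, hlt⟩
      have : 0 < A D := Finset.card_pos.mpr ⟨y, this⟩
      omega
    · rw [hz0 y hy]; exact hD.le
  set D₀ : ℝ := 64 * (2 : ℝ) ^ d * d * m * (2 * (r : ℝ) + 1) with hD₀
  have hd1 : (1 : ℝ) ≤ d := by exact_mod_cast hd
  have hr0 : (0 : ℝ) ≤ r := by exact_mod_cast hr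
  have hr1 : (1 : ℝ) ≤ 2 * (r : ℝ) + 1 := by linarith
  have hsq : 256 * (2 : ℝ) ^ d * (8 * (d : ℝ) ^ 2 * m ^ 2) * (M : ℝ) ^ 2 ≤ D₀ ^ 2 := by
    rw [hMR, hD₀]
    have h2d : (2 : ℝ) ^ d ≤ ((2 : ℝ) ^ d) ^ 2 := by
      have : (1 : ℝ) ≤ (2 : ℝ) ^ d := one_le_pow₀ (by norm_num)
      nlinarith
    have : 0 ≤ (d : ℝ) ^ 2 * m ^ 2 * (2 * (r : ℝ) + 1) ^ 2 := by positivity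
    nlinarith
  rcases eq_or_lt_of_le hm with hm0 | hmpos
  · have hall : ∀ D : ℝ, 0 < D → z y ≤ D := fun D hD => hbound D hD (by rw [← hm0]; ring_nf; positivity)
    have hle0 : z y ≤ 0 := le_of_forall_pos_le_add fun ε hε => by have := hall ε hε; linarith
    have hD00 : D₀ = 0 := by rw [hD₀, ← hm0]; ring
    rw [hD00]; exact hle0
  · have hD₀pos : 0 < D₀ := by rw [hD₀]; positivity
    exact hbound D₀ hD₀pos hsq

end Summit.QuantumFields.YangMills.Theorems.PoincareLipschitzDirichletSupOfEnergy

end
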